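import Literature.MathematicalPhysics.QuantumFieldTheory.Balaban1983to89.B8DentedCubeMemberBoxTowers
import Literature.MathematicalPhysics.QuantumFieldTheory.Balaban1983to89.B8CubeMemberBoxRowsL0

/-!
# `Balaban1983to89.B8DentedCubeMemberBoxRowsL0` — [Balaban1985RegularSpaces] (1.91) ON THE DENTED CUBE MEMBER of [Balaban1985Variational] (148)–(150), READ AS
# [Balaban1984PropagatorsII] (2.13)–(2.14) ON THE LEVEL-0 BOX FAMILY: THE ROW DICTIONARY between the p6 flat consumer's Dirichlet matrix `T = (K(x,z))` on `□₀` with the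
# DENTED cells `c.lamS` and p21's box operator `Δ′_a = mlOp` at a dented box member (`D.lev = levD`) — the dented twin of dag-n05-c's G2 `B8CubeMemberBoxRowsL0` §§2–5

statement-level skeleton of published theorems with citation tags; proofs where landed; nothing here is a claim about the Yang–Mills mass gap

`[Balaban1985RegularSpaces]` ("B8" = [6], CMP **99** (1985) 75–102) (1.91) p. 91, (1.31) p. 81, (1.131) p. 99, p. 98; `[Balaban1984PropagatorsII]` ("B6", CMP **96** (1984)
223–250) (2.13)–(2.15) p. 225, (2.1)–(2.4) p. 224, (2.45) p. 231, (2.69) p. 235; `[Balaban1985BackgroundPropagators]` ([4], CMP **99** (1985) 389–434) (3.48) p. 398;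
`[Balaban1985Variational]` ("[15]", CMP **102** (1985) 277–309) (148)–(152) p. 301.  PDF held: `paper:balaban1985-cmp99-regular-spaces-gauge-fixing`, `…-cmp102-variational-background`.

CITATION HEADER (lean-in-tree rule).  Cell `pub-ymgap` (YM Track A, HUMAN RULING D-0062), DAG node N05 = [B8], seat `pub-ymgap-dag-n05-e` (g32; FAN-OUT §N05 row s3b,
Proposition-6 lane; piece (d2-e) of the (β) road, file 2 of 3: g31 HANDOFF «Next 1 (ii)», dag-n05-c STANDING GO I.42366, this seat INTENT I.43465).  WHY THIS FILE.  G2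
(`B8CubeMemberBoxRowsL0`) is the row dictionary of dag-n05-c's exact transfer of [4] Thm 3.2 (`B8Thm32GBoundCubeMemberHolds`) at the PURE member `cubeDomainsL0` (`levL0`).
THIS FILE re-reads G2 §§2–5 for NODE 00's DENTED datum `c : CubeB8D` (cells `c.lamS`, `S ↔ c.sq 0 = □₀`) at ANY box member `D : Domains d ℓ M_h k (boxP …) R` with the
dented level function, `hD : D.lev = levD M_h c` (the member of record is r03's `TDomains.toDomains` of g31's `cubeTDomainsDented … (boxP …) …`, instantiated in file 3 with
`hD := rfl`), through file 1's tower dictionary `tower_iff_levD_eq`.  G2's generic §1 (`mlOp_row_sum`) and level-`0` block lemmas are IMPORTED by name.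

WHAT THIS FILE PROVES (kernel-checked; `L = ℓ + 1 ≥ 2`, `M_h ≥ 2`; `c : Node00.CubeB8D (d+1) (ℓ+1) K Ω`; `D` with `hD : D.lev = levD M_h c`; the consumer's letters `K`, `S`, `T`
as displayed in `GBoundDentedCubeMemberPrinted`, weights `w_j·L^{−2(d+1)j} = η⁻²·levC d ℓ aw j`).
* §2 ★ `row_eq_mlOp_row` — `Σ_{z∈□₀} K(x,z)·g(z) = η⁻²·Σ_{y∈X} Δ′_a(x + t, y)·g(y − t)` at every `x ∈ □₀` with its neighbours in `□₀`.
* §3 `blkOf_shift_val`, `blkOf_eq_shift_iff`, ★ `QB_translate` (`Q′(g(· − t))(blkOf(x + t)) = L^{−(d+1)j}Σ_{Bʲ(z) = Bʲ(x)} g(z)`), `blockMap_corner_sub_shift`,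
  `exists_site_of_pos_level` (every p21 block of positive level is the block of a translated tower site of `Ω′₁`).
* §5 ★ `mulVec_transfer`, ★★ `mulVec_mulVec_transfer` (`(T(Tf))(x) = η⁻⁴·(Δ′_a(Δ′_a f̂))(x + t)` at every `x` whose `2`-ball lies in `□₀`).

HONEST SCOPE ∕ NOT CLAIMED.  Identities (row∕block bookkeeping); no estimate.  Count-neutral; N05 ∕ N07 NOT discharged; one finite `T⁴` programme at fixed `ε`, Bałaban as
printed; nothing continuum ∕ ℝ⁴ ∕ OS ∕ mass-gap ∕ Clay.  No `sorry`, no `def`, no `instance`, no `notation`.  Unit `pub-ymgap-dag-n05-e` (g32), 2026-08-28.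

RELATED IN THE TREE, NOT DUPLICATED (`rg -l 'DentedCubeMemberBoxRows' Balaban1983to89` = 0, 2026-08-28T22:15Z): G2 `B8CubeMemberBoxRowsL0` ∕ F2 `B8CubeMemberBoxRows` (dag-n05-c;
the PURE model, generic lemmas USED by name), `B8DentedCubeMemberBoxTowers` (g32; USED), `B8CubeMemberTorusDomainsDented.levD` (g31), p21∕r03 `B6Ineq268∕B6Geom246∕…L0` (USED).
-/
noncomputable section

namespace Literature.MathematicalPhysics.QuantumFieldTheory.Balaban1983to89.B8DentedCubeMemberBoxRowsL0

open scoped Matrix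
open B6MultiLevelBoxOperator (N0 bigSide mlOp levC)
open B4Reflection242 (boxDom mem_boxDom blk nbrs mem_nbrs neumannLapK avgK card_nbrs)
open B7Prop1Explicit (e)
open B8Eq131Cubes (cube cube_anti)
open B8CubeMemberBoxDomains (shift boxP add_shift_sub_shift)
open B8CubeMemberBoxDomainsL0 (mem_boxDom_of_mem_cube_zero blockMap_pow_zero)
open B8CubeMemberTorusDomainsDented (levD levD_le levD_pos_iff)
open B8CubeMemberBoxRows (K_row_sum sum_nbrs_real pow_dvd_shift blk_add_eq_iff blockMap_eq_blk add_shift_single)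
open B8CubeMemberBoxRowsL0 (mlOp_row_sum corner_blkOf_of_lev_zero eq_corner_of_blkOf_eq_of_level_zero QB_level_zero)
open B8DentedCubeMemberBoxTowers (tower_iff_levD_eq towerBlock_subset_sq_zero good_of_K_ne_zero)
open B8Eq348CubeMemberKKT (abs_e_apply_le)
open B6Geom246MultiLevelBoxL0 (bset blkOf blkOf_val blkOf_eq_iff_blk corner corner_mem blkOf_corner lev_eq_of_blkOf_eq exists_blkOf_eq)
open B6Ineq268MultiLevelBoxL0 (W W_eq QB QB_apply)
open Node00 (CubeB8D)
open Literature.MathematicalPhysics.QuantumLattice (blockMap)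

variable {d : ℕ}

/-! ## §2 THE ROW DICTIONARY at every site of `□₀` with neighbours in `□₀` -/

open Classical in
/-- **THE ROW DICTIONARY, LEVEL `0` INCLUDED.**  Let `K` be the explicit flat multi-level Dirichlet matrix of `prop6_cubeMember_flat_of_real` at truncation `n` (`L = ℓ + 1`,
restriction sets `cubeLamS … n`, weights `w` with `w_j·L^{−2(d+1)j} = η⁻²·levC d ℓ a j` for `j ≤ n`), `S = □₀`, and let `x ∈ □₀` have all its `2(d+1)` lattice neighbours
in `□₀`.  Then for EVERY lattice function `g`: `Σ_{z∈□₀} K(x,z)·g(z) = η⁻²·Σ_{y∈X} Δ′_a(x + t, y)·g(y − t)`, `Δ′_a = mlOp` of p21 at the member `cubeDomainsL0`.  Both rows are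
`η⁻²(−Δ)` on the neighbours plus ONE averaging term at the tower level `j(x) = levL0(x + t) ∈ {0, …, n}`, whose block translates onto the block of `x + t` (`Lʲ ∣ t`).
[cite: Balaban1985RegularSpaces, (1.91) p.91, (1.131) p.99, p.98; Balaban1984PropagatorsII, (2.13)–(2.14) p.225, (2.1)–(2.4) p.224] -/
theorem row_eq_mlOp_row {ℓ Mh K' : ℕ} {Ω : ℕ → Set (Fin (d + 1) → ℤ)} (hℓ : 1 ≤ ℓ) (hMh2 : 2 ≤ Mh) (c : CubeB8D (d + 1) (ℓ + 1) K' Ω) {R : ℕ}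
    (D : B6MultiLevelBoxOperatorL0.Domains d ℓ Mh c.k (boxP ℓ c.M c.ρ c.k c.k) R) (hD : D.lev = levD Mh c)
   {η : ℝ} (w aw : ℕ → ℝ)
    (hw : ∀ j, j ≤ c.k → w j * (((((ℓ + 1 : ℕ) : ℝ) ^ (d + 1))⁻¹) ^ j) ^ 2 = (η ^ 2)⁻¹ * levC d ℓ aw j)
    (K : (Fin (d + 1) → ℤ) → (Fin (d + 1) → ℤ) → ℝ)
    (hK : ∀ x z, K x z = ((η ^ 2)⁻¹ * ∑ μ : Fin (d + 1), ((2 : ℝ) * (if z = x then (1 : ℝ) else 0) - (if z = x + e μ then (1 : ℝ) else 0)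
        - (if z = x - e μ then (1 : ℝ) else 0))) +
        (∑ j ∈ Finset.range (c.k + 1), (if blockMap ((ℓ + 1) ^ j) x ∈ c.lamS j ∧
            blockMap ((ℓ + 1) ^ j) z = blockMap ((ℓ + 1) ^ j) x then
          w j * (((((ℓ + 1 : ℕ) : ℝ) ^ (d + 1))⁻¹) ^ j) ^ 2 else 0)))
    (S : Finset (Fin (d + 1) → ℤ)) (hS : ∀ z, z ∈ S ↔ z ∈ c.sq 0)
    (y : ↥(boxDom (N0 ℓ Mh c.k (boxP ℓ c.M c.ρ c.k c.k)))) {x : Fin (d + 1) → ℤ} (hyx : y.1 = x + shift ℓ Mh c.a c.ρ c.k c.k)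
    (hx : x ∈ cube (ℓ + 1) c.a c.M c.ρ c.k 0) (hxe : ∀ μ, x + e μ ∈ cube (ℓ + 1) c.a c.M c.ρ c.k 0 ∧ x - e μ ∈ cube (ℓ + 1) c.a c.M c.ρ c.k 0)
    (g : (Fin (d + 1) → ℤ) → ℝ) :
    ∑ z ∈ S, K x z * g z
      = (η ^ 2)⁻¹ * ∑ y' : ↥(boxDom (N0 ℓ Mh c.k (boxP ℓ c.M c.ρ c.k c.k))),
          mlOp (N0 ℓ Mh c.k (boxP ℓ c.M c.ρ c.k c.k)) ℓ c.k (levD Mh c) aw y y' * g (y'.1 - shift ℓ Mh c.a c.ρ c.k c.k) := by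
  have hL : 1 ≤ ℓ + 1 := Nat.succ_pos ℓ
  set t := shift ℓ Mh c.a c.ρ c.k c.k with ht
  have h00 : cube (ℓ + 1) c.a c.M c.ρ c.k 0 = c.sq 0 := c.sq_zero.symm
  have hxS : x ∈ S := (hS x).mpr (by rw [← h00]; exact hx)
  have hxeS : ∀ μ, x + e μ ∈ S ∧ x - e μ ∈ S := fun μ =>
    ⟨(hS _).mpr (by rw [← h00]; exact (hxe μ).1), (hS _).mpr (by rw [← h00]; exact (hxe μ).2)⟩
  -- the consumer's row
  rw [K_row_sum (ℓ + 1) c.k c.lamS w K (by simpa using hK) S hxS hxeS g]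
  -- p21's row at `y`, read through the member
  have hnb : ∀ μ, y.1 + Pi.single μ 1 ∈ boxDom (N0 ℓ Mh c.k (boxP ℓ c.M c.ρ c.k c.k)) ∧
      y.1 - Pi.single μ 1 ∈ boxDom (N0 ℓ Mh c.k (boxP ℓ c.M c.ρ c.k c.k)) := by
    intro μ
    obtain ⟨h1, h2⟩ := add_shift_single t x μ
    rw [hyx]
    exact ⟨by rw [h1]; exact mem_boxDom_of_mem_cube_zero hℓ hMh2 c.a c.one_le_k le_rfl (hxe μ).1,
      by rw [h2]; exact mem_boxDom_of_mem_cube_zero hℓ hMh2 c.a c.one_le_k le_rfl (hxe μ).2⟩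
  have hrow := mlOp_row_sum D aw y hnb (fun z => g (z - t))
  rw [show (levD Mh c) = D.lev from hD.symm, hrow]
  -- the Laplacian parts agree after translating back
  obtain hj := fun μ => add_shift_single t x μ
  have hlap : ∑ μ : Fin (d + 1), (2 * g (y.1 - t) - g (y.1 + Pi.single μ 1 - t) - g (y.1 - Pi.single μ 1 - t))
      = ∑ μ : Fin (d + 1), (2 * g x - g (x + e μ) - g (x - e μ)) := by
    refine Finset.sum_congr rfl fun μ _ => ?_
    rw [hyx, (hj μ).1, (hj μ).2]
    simp only [ht, add_shift_sub_shift]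
  rw [hlap, mul_add]
  congr 1
  -- the averaging parts: the sum over levels collapses to the tower level `j₀ = levD (x + t)`
  set j₀ := D.lev y.1 with hj₀
  have hj₀' : levD Mh c (x + t) = j₀ := by rw [hj₀, hyx, hD]
  have hj₀n : j₀ ≤ c.k := by rw [← hj₀']; exact levD_le Mh c _
  have hcollapse : ∀ j ∈ Finset.range (c.k + 1),
      (if blockMap ((ℓ + 1) ^ j) x ∈ c.lamS j then
        w j * (((((ℓ + 1 : ℕ) : ℝ) ^ (d + 1))⁻¹) ^ j) ^ 2 *
          ∑ z ∈ S.filter (fun z => blockMap ((ℓ + 1) ^ j) z = blockMap ((ℓ + 1) ^ j) x), g z else 0)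
      = if j₀ = j then w j * (((((ℓ + 1 : ℕ) : ℝ) ^ (d + 1))⁻¹) ^ j) ^ 2 *
          ∑ z ∈ S.filter (fun z => blockMap ((ℓ + 1) ^ j) z = blockMap ((ℓ + 1) ^ j) x), g z else 0 := by
    intro j hj
    have hjn : j ≤ c.k := Nat.lt_succ_iff.mp (Finset.mem_range.mp hj)
    have hiff := tower_iff_levD_eq c hjn hx (Mh := Mh)
    rw [hj₀'] at hiff
    by_cases h : blockMap ((ℓ + 1) ^ j) x ∈ c.lamS j
    · rw [if_pos h, if_pos (hiff.mp h)]
    · rw [if_neg h, if_neg (fun h' => h (hiff.mpr h'))]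
  rw [Finset.sum_congr rfl hcollapse, Finset.sum_ite_eq, if_pos (Finset.mem_range.mpr (Nat.lt_succ_of_le hj₀n))]
  -- `x` is at tower level `j₀`
  have htower : blockMap ((ℓ + 1) ^ j₀) x ∈ c.lamS j₀ :=
    (tower_iff_levD_eq c hj₀n hx (Mh := Mh)).mpr hj₀'
  -- the block sums agree under `z ↦ z + t` (`L^{j₀} ∣ t`)
  have hdvd : ∀ i, (((ℓ + 1) ^ j₀ : ℕ) : ℤ) ∣ t i := fun i => by
    have := pow_dvd_shift ℓ Mh c.a c.ρ hj₀n le_rfl i (d := d)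
    push_cast at this ⊢; exact this
  have hb : 1 ≤ (ℓ + 1) ^ j₀ := Nat.one_le_pow _ _ hL
  have hyt : y.1 = x + t := hyx
  have hblocks : (∑ z ∈ S.filter (fun z => blockMap ((ℓ + 1) ^ j₀) z = blockMap ((ℓ + 1) ^ j₀) x), g z)
      = ∑ y' ∈ (boxDom (N0 ℓ Mh c.k (boxP ℓ c.M c.ρ c.k c.k))).filter (fun y' => blk ((ℓ + 1) ^ j₀) y' = blk ((ℓ + 1) ^ j₀) y.1),
          g (y' - t) := by
    refine Finset.sum_nbij' (fun z => z + t) (fun y' => y' - t) ?_ ?_ ?_ ?_ ?_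
    · intro z hz
      rw [Finset.mem_filter] at hz ⊢
      obtain ⟨hzS, hzq⟩ := hz
      have hzq' : blk ((ℓ + 1) ^ j₀) z = blk ((ℓ + 1) ^ j₀) x := by rw [← blockMap_eq_blk, ← blockMap_eq_blk]; exact hzq
      have hz0 : z ∈ cube (ℓ + 1) c.a c.M c.ρ c.k 0 := by
        rw [h00]; exact towerBlock_subset_sq_zero c hj₀n htower hzq
      refine ⟨mem_boxDom_of_mem_cube_zero hℓ hMh2 c.a c.one_le_k le_rfl hz0, ?_⟩
      rw [hyt]; exact (blk_add_eq_iff hb hdvd z x).mpr hzq'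
    · intro y' hy'
      rw [Finset.mem_filter] at hy' ⊢
      obtain ⟨hyb, hyq⟩ := hy'
      have hq : blk ((ℓ + 1) ^ j₀) (y' - t) = blk ((ℓ + 1) ^ j₀) x := by
        rw [← blk_add_eq_iff hb hdvd (y' - t) x, sub_add_cancel, ← hyt]; exact hyq
      refine ⟨(hS _).mpr ?_, ?_⟩
      · exact towerBlock_subset_sq_zero c hj₀n htower (by rw [blockMap_eq_blk]; exact hq)
      · rw [blockMap_eq_blk, blockMap_eq_blk]; exact hq
    · intro z _; exact add_sub_cancel_right z t
    · intro y' _; exact sub_add_cancel y' t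
    · intro z _; rw [add_sub_cancel_right]
  rw [hblocks, ← mul_assoc, hw j₀ hj₀n, mul_assoc]

/-! ## §3 The tower dictionary at every level -/

/-- **THE p21 BLOCK OF A TRANSLATED SITE OF `□₀`**: for `x ∈ □₀` with tower `(j, Bʲ(x))` (`Bʲ(x) ∈ Λs_j`, `j ≤ n`, `j = 0` admitted) and a box site `y = x + t`, the block
`blkOf` of `y` in the dented box member `D` (`D.lev = levD`) is `(j, blk_{Lʲ}(y))`. [cite: Balaban1984PropagatorsII, (2.1)–(2.4) p.224, (2.45) p.231; Balaban1985RegularSpaces, (1.31) p.81, (1.131) p.99] -/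
theorem blkOf_shift_val {ℓ Mh K' : ℕ} {Ω : ℕ → Set (Fin (d + 1) → ℤ)} (c : CubeB8D (d + 1) (ℓ + 1) K' Ω) {R : ℕ}
    (D : B6MultiLevelBoxOperatorL0.Domains d ℓ Mh c.k (boxP ℓ c.M c.ρ c.k c.k) R) (hD : D.lev = levD Mh c)
   (y : ↥(boxDom (N0 ℓ Mh c.k (boxP ℓ c.M c.ρ c.k c.k)))) {x : Fin (d + 1) → ℤ} (hyx : y.1 = x + shift ℓ Mh c.a c.ρ c.k c.k)
    (hx0 : x ∈ cube (ℓ + 1) c.a c.M c.ρ c.k 0) {j : ℕ} (hjn : j ≤ c.k) (hxj : blockMap ((ℓ + 1) ^ j) x ∈ c.lamS j) :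
    (blkOf D y).1 = (j, blk ((ℓ + 1) ^ j) y.1) := by
  have hlev : D.lev y.1 = j := by
    rw [hD, hyx]; exact (tower_iff_levD_eq c hjn hx0 (Mh := Mh)).mp hxj
  rw [blkOf_val]
  change (D.lev y.1, blk ((ℓ + 1) ^ D.lev y.1) y.1) = (j, blk ((ℓ + 1) ^ j) y.1)
  rw [hlev]

/-- **THE SITES OF THAT p21 BLOCK ARE THE TRANSLATED SITES OF THE CONSUMER'S TOWER BLOCK**: with `x, y, j` as above and any box site `y′`,
`blkOf y′ = blkOf y ⇔ Bʲ(y′ − t) = Bʲ(x)` (`Lʲ ∣ t`). [cite: Balaban1984PropagatorsII, (2.1)–(2.4) p.224, (2.45) p.231; Balaban1985RegularSpaces, (1.31) p.81, p.79] -/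
theorem blkOf_eq_shift_iff {ℓ Mh K' : ℕ} {Ω : ℕ → Set (Fin (d + 1) → ℤ)} (c : CubeB8D (d + 1) (ℓ + 1) K' Ω) {R : ℕ}
    (D : B6MultiLevelBoxOperatorL0.Domains d ℓ Mh c.k (boxP ℓ c.M c.ρ c.k c.k) R) (hD : D.lev = levD Mh c)
   (y : ↥(boxDom (N0 ℓ Mh c.k (boxP ℓ c.M c.ρ c.k c.k)))) {x : Fin (d + 1) → ℤ} (hyx : y.1 = x + shift ℓ Mh c.a c.ρ c.k c.k)
    (hx0 : x ∈ cube (ℓ + 1) c.a c.M c.ρ c.k 0) {j : ℕ} (hjn : j ≤ c.k) (hxj : blockMap ((ℓ + 1) ^ j) x ∈ c.lamS j)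
    (y' : ↥(boxDom (N0 ℓ Mh c.k (boxP ℓ c.M c.ρ c.k c.k)))) :
    blkOf D y' = blkOf D y
      ↔ blockMap ((ℓ + 1) ^ j) (y'.1 - shift ℓ Mh c.a c.ρ c.k c.k) = blockMap ((ℓ + 1) ^ j) x := by
  have hL : 1 ≤ ℓ + 1 := Nat.succ_pos ℓ
  have hLj : 1 ≤ (ℓ + 1) ^ j := Nat.one_le_pow _ _ hL
  have hdvd : ∀ i, (((ℓ + 1) ^ j : ℕ) : ℤ) ∣ shift ℓ Mh c.a c.ρ c.k c.k i := fun i => pow_dvd_shift ℓ Mh c.a c.ρ hjn le_rfl i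
  have hval := blkOf_shift_val c D hD y hyx hx0 hjn hxj
  rw [blkOf_eq_iff_blk]
  have h1 : (blkOf D y).1.1 = j := by rw [hval]
  have h2 : (blkOf D y).1.2 = blk ((ℓ + 1) ^ j) y.1 := by rw [hval]
  rw [h1, h2, hyx]
  have hy' : y'.1 = (y'.1 - shift ℓ Mh c.a c.ρ c.k c.k) + shift ℓ Mh c.a c.ρ c.k c.k := (sub_add_cancel _ _).symm
  conv_lhs => rw [hy']
  rw [blk_add_eq_iff hLj hdvd, blockMap_eq_blk, blockMap_eq_blk]

open Classical in
/-- **`Q′` OF A TRANSLATED FUNCTION = THE CONSUMER'S BLOCK AVERAGE, AT EVERY LEVEL**: for `x ∈ □₀` with tower `(j, Bʲ(x))`, `y = x + t` and `g` on the lattice,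
`(Q′(g(· − t)))(blkOf y) = L^{−(d+1)j}·Σ_{z ∈ □₀, Bʲ(z) = Bʲ(x)} g(z)` — p21's `QB` on the member `cubeDomainsL0` read at the cube member (at `j = 0`: `g(x)`).
[cite: Balaban1984PropagatorsII, (2.14)–(2.15) p.225, (2.69) p.235; Balaban1985RegularSpaces, (1.31) p.81, p.91 (the operator `Q′`)] -/
theorem QB_translate {ℓ Mh K' : ℕ} {Ω : ℕ → Set (Fin (d + 1) → ℤ)} (hℓ : 1 ≤ ℓ) (hMh2 : 2 ≤ Mh) (c : CubeB8D (d + 1) (ℓ + 1) K' Ω) {R : ℕ}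
    (D : B6MultiLevelBoxOperatorL0.Domains d ℓ Mh c.k (boxP ℓ c.M c.ρ c.k c.k) R) (hD : D.lev = levD Mh c)
   (S : Finset (Fin (d + 1) → ℤ)) (hS : ∀ z, z ∈ S ↔ z ∈ c.sq 0)
    (y : ↥(boxDom (N0 ℓ Mh c.k (boxP ℓ c.M c.ρ c.k c.k)))) {x : Fin (d + 1) → ℤ} (hyx : y.1 = x + shift ℓ Mh c.a c.ρ c.k c.k)
    (hx0 : x ∈ cube (ℓ + 1) c.a c.M c.ρ c.k 0) {j : ℕ} (hjn : j ≤ c.k) (hxj : blockMap ((ℓ + 1) ^ j) x ∈ c.lamS j)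
    (g : (Fin (d + 1) → ℤ) → ℝ) :
    QB D (fun y' => g (y'.1 - shift ℓ Mh c.a c.ρ c.k c.k))
        (blkOf D y)
      = (((((ℓ : ℝ) + 1) ^ j) ^ (d + 1)))⁻¹ * ∑ z ∈ S.filter (fun z => blockMap ((ℓ + 1) ^ j) z = blockMap ((ℓ + 1) ^ j) x), g z := by
  have hL : 1 ≤ ℓ + 1 := Nat.succ_pos ℓ
  have h00 : cube (ℓ + 1) c.a c.M c.ρ c.k 0 = c.sq 0 := c.sq_zero.symm
  set s₀ := blkOf D y with hs₀
  have hval : s₀.1 = (j, blk ((ℓ + 1) ^ j) y.1) := blkOf_shift_val c D hD y hyx hx0 hjn hxj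
  rw [QB_apply, W_eq, show s₀.1.1 = j by rw [hval]]
  congr 1
  -- the bijection `y′ ↦ y′ − t` between the sites of the p21 block and the sites of the consumer's tower block
  have hmem0 : ∀ z, blockMap ((ℓ + 1) ^ j) z = blockMap ((ℓ + 1) ^ j) x → z ∈ cube (ℓ + 1) c.a c.M c.ρ c.k 0 := fun z hz => by
    rw [h00]; exact towerBlock_subset_sq_zero c hjn hxj hz
  have hmemS : ∀ z, blockMap ((ℓ + 1) ^ j) z = blockMap ((ℓ + 1) ^ j) x → z ∈ S := fun z hz =>
    (hS z).mpr (towerBlock_subset_sq_zero c hjn hxj hz)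
  symm
  refine Finset.sum_nbij' (fun z => if h : z + shift ℓ Mh c.a c.ρ c.k c.k ∈ boxDom (N0 ℓ Mh c.k (boxP ℓ c.M c.ρ c.k c.k)) then ⟨z + shift ℓ Mh c.a c.ρ c.k c.k, h⟩ else y)
    (fun y' => y'.1 - shift ℓ Mh c.a c.ρ c.k c.k) ?_ ?_ ?_ ?_ ?_
  · -- into the p21 block
    intro z hz
    have hzb := (Finset.mem_filter.mp hz).2
    have hbox : z + shift ℓ Mh c.a c.ρ c.k c.k ∈ boxDom (N0 ℓ Mh c.k (boxP ℓ c.M c.ρ c.k c.k)) := mem_boxDom_of_mem_cube_zero hℓ hMh2 c.a c.one_le_k le_rfl (hmem0 z hzb)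
    rw [dif_pos hbox, Finset.mem_filter]
    refine ⟨Finset.mem_univ _, ?_⟩
    rw [hs₀, blkOf_eq_shift_iff c D hD y hyx hx0 hjn hxj]
    change blockMap ((ℓ + 1) ^ j) (z + shift ℓ Mh c.a c.ρ c.k c.k - shift ℓ Mh c.a c.ρ c.k c.k) = blockMap ((ℓ + 1) ^ j) x
    rw [add_sub_cancel_right]; exact hzb
  · -- onto the consumer block
    intro y' hy'
    have hb := (Finset.mem_filter.mp hy').2
    rw [hs₀, blkOf_eq_shift_iff c D hD y hyx hx0 hjn hxj] at hb
    exact Finset.mem_filter.mpr ⟨hmemS _ hb, hb⟩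
  · -- left inverse
    intro z hz
    have hzb := (Finset.mem_filter.mp hz).2
    have hbox : z + shift ℓ Mh c.a c.ρ c.k c.k ∈ boxDom (N0 ℓ Mh c.k (boxP ℓ c.M c.ρ c.k c.k)) := mem_boxDom_of_mem_cube_zero hℓ hMh2 c.a c.one_le_k le_rfl (hmem0 z hzb)
    rw [dif_pos hbox]
    exact add_sub_cancel_right _ _
  · -- right inverse
    intro y' hy'
    have hbox : y'.1 - shift ℓ Mh c.a c.ρ c.k c.k + shift ℓ Mh c.a c.ρ c.k c.k ∈ boxDom (N0 ℓ Mh c.k (boxP ℓ c.M c.ρ c.k c.k)) := by rw [sub_add_cancel]; exact y'.2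
    rw [dif_pos hbox]
    exact Subtype.ext (sub_add_cancel _ _)
  · -- the summands agree
    intro z hz
    have hzb := (Finset.mem_filter.mp hz).2
    have hbox : z + shift ℓ Mh c.a c.ρ c.k c.k ∈ boxDom (N0 ℓ Mh c.k (boxP ℓ c.M c.ρ c.k c.k)) := mem_boxDom_of_mem_cube_zero hℓ hMh2 c.a c.one_le_k le_rfl (hmem0 z hzb)
    rw [dif_pos hbox]
    change g z = g (z + shift ℓ Mh c.a c.ρ c.k c.k - shift ℓ Mh c.a c.ρ c.k c.k)
    rw [add_sub_cancel_right]

/-- **THE CORNER OF THE p21 BLOCK OF `x + t` LIES IN THE CONSUMER'S TOWER OF `x`**: `Bʲ(corner(blkOf(x + t)) − t) = Bʲ(x)`. [cite: Balaban1984PropagatorsII, (2.1) p.224, (2.45) p.231; Balaban1985RegularSpaces, (1.31) p.81] -/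
theorem blockMap_corner_sub_shift {ℓ Mh K' : ℕ} {Ω : ℕ → Set (Fin (d + 1) → ℤ)} (c : CubeB8D (d + 1) (ℓ + 1) K' Ω) {R : ℕ}
    (D : B6MultiLevelBoxOperatorL0.Domains d ℓ Mh c.k (boxP ℓ c.M c.ρ c.k c.k) R) (hD : D.lev = levD Mh c)
   (y : ↥(boxDom (N0 ℓ Mh c.k (boxP ℓ c.M c.ρ c.k c.k)))) {x : Fin (d + 1) → ℤ} (hyx : y.1 = x + shift ℓ Mh c.a c.ρ c.k c.k)
    (hx0 : x ∈ cube (ℓ + 1) c.a c.M c.ρ c.k 0) {j : ℕ} (hjn : j ≤ c.k) (hxj : blockMap ((ℓ + 1) ^ j) x ∈ c.lamS j) :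
    blockMap ((ℓ + 1) ^ j) (corner D (blkOf D y) - shift ℓ Mh c.a c.ρ c.k c.k)
      = blockMap ((ℓ + 1) ^ j) x := by
  have h := blkOf_corner D (blkOf D y)
  exact (blkOf_eq_shift_iff c D hD y hyx hx0 hjn hxj ⟨_, corner_mem _ _⟩).mp h

/-- **EVERY p21 BLOCK OF POSITIVE LEVEL IS THE BLOCK OF A TRANSLATED TOWER SITE OF `□₁`**: for `s ∈ 𝔅` with `1 ≤ level(s)` there is `x ∈ □₁` (so `x ∈ □₀`) in the consumer's
tower `(level(s), B(x))` with `blkOf (x + t) = s`. [cite: Balaban1984PropagatorsII, (2.1)–(2.4) p.224, (2.45) p.231; Balaban1985RegularSpaces, (1.131) p.99] -/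
theorem exists_site_of_pos_level {ℓ Mh K' : ℕ} {Ω : ℕ → Set (Fin (d + 1) → ℤ)} (c : CubeB8D (d + 1) (ℓ + 1) K' Ω) {R : ℕ}
    (D : B6MultiLevelBoxOperatorL0.Domains d ℓ Mh c.k (boxP ℓ c.M c.ρ c.k c.k) R) (hD : D.lev = levD Mh c)
   (s : ↥(bset D)) (hs : 1 ≤ s.1.1) :
    ∃ (y : ↥(boxDom (N0 ℓ Mh c.k (boxP ℓ c.M c.ρ c.k c.k)))) (x : Fin (d + 1) → ℤ), y.1 = x + shift ℓ Mh c.a c.ρ c.k c.k ∧ x ∈ c.sq 1 ∧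
      x ∈ cube (ℓ + 1) c.a c.M c.ρ c.k 0 ∧ s.1.1 ≤ c.k ∧ blockMap ((ℓ + 1) ^ s.1.1) x ∈ c.lamS s.1.1 ∧
      blkOf D y = s := by
  have hk : 1 ≤ c.k := c.one_le_k
  obtain ⟨y, hy⟩ := exists_blkOf_eq D s
  have hlev : levD Mh c y.1 = s.1.1 := by rw [← hD]; exact lev_eq_of_blkOf_eq D hy
  set x := y.1 - shift ℓ Mh c.a c.ρ c.k c.k with hx
  have hyx : y.1 = x + shift ℓ Mh c.a c.ρ c.k c.k := (sub_add_cancel _ _).symm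
  have hx1 : x ∈ c.sq 1 := (levD_pos_iff Mh c y.1).mp (by rw [hlev]; exact hs)
  have hx0 : x ∈ cube (ℓ + 1) c.a c.M c.ρ c.k 0 := cube_anti (Nat.zero_le 1) hk (c.sq_subset_cube hk hx1)
  have hsn : s.1.1 ≤ c.k := by rw [← hlev]; exact levD_le Mh c _
  have htower : blockMap ((ℓ + 1) ^ s.1.1) x ∈ c.lamS s.1.1 := by
    refine (tower_iff_levD_eq c hsn hx0 (Mh := Mh)).mpr ?_
    rw [← hyx]; exact hlev
  exact ⟨y, x, hyx, hx1, hx0, hsn, htower, hy⟩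

/-! ## §5 Products transported: `T·f` and `T²·f` at deep sites are `η⁻²Δ′_a f̂`, `η⁻⁴Δ′_a²f̂` of the translated zero extension -/

open Classical in
/-- **`(Tf)(x) = η⁻²·(Δ′_a f̂)(x + t)`** at every `x ∈ □₀` with its neighbours in `□₀`, where `f̂(y) = f(y − t)` on `t + □₀` and `0` elsewhere (the zero extension translated).
[cite: Balaban1985RegularSpaces, (1.91) p.91; Balaban1984PropagatorsII, (2.13)–(2.14) p.225] -/
theorem mulVec_transfer {ℓ Mh K' : ℕ} {Ω : ℕ → Set (Fin (d + 1) → ℤ)} (hℓ : 1 ≤ ℓ) (hMh2 : 2 ≤ Mh) (c : CubeB8D (d + 1) (ℓ + 1) K' Ω) {R : ℕ}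
    (D : B6MultiLevelBoxOperatorL0.Domains d ℓ Mh c.k (boxP ℓ c.M c.ρ c.k c.k) R) (hD : D.lev = levD Mh c)
   {η : ℝ} (w aw : ℕ → ℝ)
    (hw : ∀ j, j ≤ c.k → w j * (((((ℓ + 1 : ℕ) : ℝ) ^ (d + 1))⁻¹) ^ j) ^ 2 = (η ^ 2)⁻¹ * levC d ℓ aw j)
    (K : (Fin (d + 1) → ℤ) → (Fin (d + 1) → ℤ) → ℝ)
    (hK : ∀ x z, K x z = ((η ^ 2)⁻¹ * ∑ μ : Fin (d + 1), ((2 : ℝ) * (if z = x then (1 : ℝ) else 0) - (if z = x + e μ then (1 : ℝ) else 0)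
        - (if z = x - e μ then (1 : ℝ) else 0))) +
        (∑ j ∈ Finset.range (c.k + 1), (if blockMap ((ℓ + 1) ^ j) x ∈ c.lamS j ∧
            blockMap ((ℓ + 1) ^ j) z = blockMap ((ℓ + 1) ^ j) x then
          w j * (((((ℓ + 1 : ℕ) : ℝ) ^ (d + 1))⁻¹) ^ j) ^ 2 else 0)))
    (S : Finset (Fin (d + 1) → ℤ)) (hS : ∀ z, z ∈ S ↔ z ∈ c.sq 0)
    (T : Matrix ↥S ↥S ℝ) (hT : T = Matrix.of (fun x z : ↥S => K x.1 z.1))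
    (f : ↥S → ℝ) (fh : ↥(boxDom (N0 ℓ Mh c.k (boxP ℓ c.M c.ρ c.k c.k))) → ℝ)
    (hfh : ∀ y : ↥(boxDom (N0 ℓ Mh c.k (boxP ℓ c.M c.ρ c.k c.k))),
      fh y = if h : y.1 - shift ℓ Mh c.a c.ρ c.k c.k ∈ S then f ⟨y.1 - shift ℓ Mh c.a c.ρ c.k c.k, h⟩ else 0)
    (x : ↥S) (hxe : ∀ μ, x.1 + e μ ∈ cube (ℓ + 1) c.a c.M c.ρ c.k 0 ∧ x.1 - e μ ∈ cube (ℓ + 1) c.a c.M c.ρ c.k 0)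
    (y : ↥(boxDom (N0 ℓ Mh c.k (boxP ℓ c.M c.ρ c.k c.k)))) (hyx : y.1 = x.1 + shift ℓ Mh c.a c.ρ c.k c.k) :
    (T *ᵥ f) x = (η ^ 2)⁻¹ * (mlOp (N0 ℓ Mh c.k (boxP ℓ c.M c.ρ c.k c.k)) ℓ c.k (levD Mh c) aw *ᵥ fh) y := by
  have h00 : cube (ℓ + 1) c.a c.M c.ρ c.k 0 = c.sq 0 := c.sq_zero.symm
  have hx0 : x.1 ∈ cube (ℓ + 1) c.a c.M c.ρ c.k 0 := by rw [h00]; exact (hS x.1).mp x.2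
  -- the zero extension of `f`
  set g : (Fin (d + 1) → ℤ) → ℝ := fun z => if h : z ∈ S then f ⟨z, h⟩ else 0 with hg
  have hTf : (T *ᵥ f) x = ∑ z ∈ S, K x.1 z * g z := by
    rw [Matrix.mulVec, dotProduct, ← Finset.sum_coe_sort S]
    refine Finset.sum_congr rfl fun z _ => ?_
    rw [hT, Matrix.of_apply, hg]
    simp only [dif_pos z.2]
  rw [hTf, row_eq_mlOp_row hℓ hMh2 c D hD w aw hw K hK S hS y hyx hx0 hxe g, Matrix.mulVec, dotProduct]
  congr 1
  refine Finset.sum_congr rfl fun y' _ => ?_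
  rw [hfh y']

open Classical in
/-- **`(T(Tf))(x) = η⁻⁴·(Δ′_a(Δ′_a f̂))(x + t)`** at every `x ∈ □₀` whose `2`-ball lies in `□₀` (G0 `good_of_K_ne_zero`: every site in the support of the row `K(x,·)` has its
neighbours in `□₀`, so the inner product transfers site by site; the outer row transfers by §2). [cite: Balaban1985RegularSpaces, (1.91) p.91; Balaban1984PropagatorsII, (2.13)–(2.14) p.225; Balaban1985BackgroundPropagators, (3.48) p.398] -/
theorem mulVec_mulVec_transfer {ℓ Mh K' : ℕ} {Ω : ℕ → Set (Fin (d + 1) → ℤ)} (hℓ : 1 ≤ ℓ) (hMh2 : 2 ≤ Mh) (c : CubeB8D (d + 1) (ℓ + 1) K' Ω) {R : ℕ}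
    (D : B6MultiLevelBoxOperatorL0.Domains d ℓ Mh c.k (boxP ℓ c.M c.ρ c.k c.k) R) (hD : D.lev = levD Mh c)
   {η : ℝ} (w aw : ℕ → ℝ)
    (hw : ∀ j, j ≤ c.k → w j * (((((ℓ + 1 : ℕ) : ℝ) ^ (d + 1))⁻¹) ^ j) ^ 2 = (η ^ 2)⁻¹ * levC d ℓ aw j)
    (K : (Fin (d + 1) → ℤ) → (Fin (d + 1) → ℤ) → ℝ)
    (hK : ∀ x z, K x z = ((η ^ 2)⁻¹ * ∑ μ : Fin (d + 1), ((2 : ℝ) * (if z = x then (1 : ℝ) else 0) - (if z = x + e μ then (1 : ℝ) else 0)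
        - (if z = x - e μ then (1 : ℝ) else 0))) +
        (∑ j ∈ Finset.range (c.k + 1), (if blockMap ((ℓ + 1) ^ j) x ∈ c.lamS j ∧
            blockMap ((ℓ + 1) ^ j) z = blockMap ((ℓ + 1) ^ j) x then
          w j * (((((ℓ + 1 : ℕ) : ℝ) ^ (d + 1))⁻¹) ^ j) ^ 2 else 0)))
    (S : Finset (Fin (d + 1) → ℤ)) (hS : ∀ z, z ∈ S ↔ z ∈ c.sq 0)
    (T : Matrix ↥S ↥S ℝ) (hT : T = Matrix.of (fun x z : ↥S => K x.1 z.1))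
    (f : ↥S → ℝ) (fh : ↥(boxDom (N0 ℓ Mh c.k (boxP ℓ c.M c.ρ c.k c.k))) → ℝ)
    (hfh : ∀ y : ↥(boxDom (N0 ℓ Mh c.k (boxP ℓ c.M c.ρ c.k c.k))),
      fh y = if h : y.1 - shift ℓ Mh c.a c.ρ c.k c.k ∈ S then f ⟨y.1 - shift ℓ Mh c.a c.ρ c.k c.k, h⟩ else 0)
    (x : ↥S) (hx2 : ∀ τ : Fin (d + 1) → ℤ, (∀ i, |τ i| ≤ 2) → x.1 + τ ∈ cube (ℓ + 1) c.a c.M c.ρ c.k 0)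
    (y : ↥(boxDom (N0 ℓ Mh c.k (boxP ℓ c.M c.ρ c.k c.k)))) (hyx : y.1 = x.1 + shift ℓ Mh c.a c.ρ c.k c.k) :
    (T *ᵥ (T *ᵥ f)) x = ((η ^ 2)⁻¹) ^ 2 *
      (mlOp (N0 ℓ Mh c.k (boxP ℓ c.M c.ρ c.k c.k)) ℓ c.k (levD Mh c) aw *ᵥ
        (mlOp (N0 ℓ Mh c.k (boxP ℓ c.M c.ρ c.k c.k)) ℓ c.k (levD Mh c) aw *ᵥ fh)) y := by
  have hL : 1 ≤ ℓ + 1 := Nat.succ_pos ℓ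
  have h00 : cube (ℓ + 1) c.a c.M c.ρ c.k 0 = c.sq 0 := c.sq_zero.symm
  have hx0 : x.1 ∈ cube (ℓ + 1) c.a c.M c.ρ c.k 0 := by rw [h00]; exact (hS x.1).mp x.2
  set t := shift ℓ Mh c.a c.ρ c.k c.k with ht
  have hxe : ∀ μ, x.1 + e μ ∈ cube (ℓ + 1) c.a c.M c.ρ c.k 0 ∧ x.1 - e μ ∈ cube (ℓ + 1) c.a c.M c.ρ c.k 0 := fun μ =>
    ⟨hx2 (e μ) (fun i => (abs_e_apply_le μ i).trans (by norm_num)), by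
      rw [sub_eq_add_neg]
      exact hx2 (-e μ) (fun i => by rw [Pi.neg_apply, abs_neg]; exact (abs_e_apply_le μ i).trans (by norm_num))⟩
  -- a row of `T` as a sum over the finite set `S`
  have hTrow : ∀ (v : ↥S → ℝ) (x' : ↥S), (T *ᵥ v) x' = ∑ z : ↥S, K x'.1 z.1 * v z := fun v x' => by
    simp only [hT, Matrix.mulVec, dotProduct, Matrix.of_apply]
  -- the inner products, transported on the support of the row `K(x, ·)`
  set g₂ : (Fin (d + 1) → ℤ) → ℝ := fun w' =>
    if h : w' + t ∈ boxDom (N0 ℓ Mh c.k (boxP ℓ c.M c.ρ c.k c.k)) then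
      (η ^ 2)⁻¹ * (mlOp (N0 ℓ Mh c.k (boxP ℓ c.M c.ρ c.k c.k)) ℓ c.k (levD Mh c) aw *ᵥ fh) ⟨w' + t, h⟩ else 0 with hg₂
  have hinner : ∀ z : ↥S, K x.1 z.1 ≠ 0 → (T *ᵥ f) z = g₂ z.1 := by
    intro z hz
    obtain ⟨hz0, hze⟩ := good_of_K_ne_zero c w K hK hx2 hz
    have hzt : z.1 + t ∈ boxDom (N0 ℓ Mh c.k (boxP ℓ c.M c.ρ c.k c.k)) := mem_boxDom_of_mem_cube_zero hℓ hMh2 c.a c.one_le_k le_rfl hz0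
    have hval : g₂ z.1 = (η ^ 2)⁻¹ * (mlOp (N0 ℓ Mh c.k (boxP ℓ c.M c.ρ c.k c.k)) ℓ c.k (levD Mh c) aw *ᵥ fh) ⟨z.1 + t, hzt⟩ := by
      simp only [hg₂, dif_pos hzt]
    rw [hval]
    exact mulVec_transfer hℓ hMh2 c D hD w aw hw K hK S hS T hT f fh hfh z hze ⟨z.1 + t, hzt⟩ rfl
  have h1 : (T *ᵥ (T *ᵥ f)) x = ∑ z ∈ S, K x.1 z * g₂ z := by
    rw [hTrow, ← Finset.sum_coe_sort S]
    refine Finset.sum_congr rfl fun z _ => ?_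
    by_cases hz : K x.1 z.1 = 0
    · rw [hz, zero_mul, zero_mul]
    · rw [hinner z hz]
  rw [h1, row_eq_mlOp_row hℓ hMh2 c D hD w aw hw K hK S hS y hyx hx0 hxe g₂]
  -- unfold the transported inner products: `g₂(y′ − t) = η⁻²(Δ′_a f̂)(y′)`
  have hg₂y : ∀ y' : ↥(boxDom (N0 ℓ Mh c.k (boxP ℓ c.M c.ρ c.k c.k))),
      g₂ (y'.1 - t) = (η ^ 2)⁻¹ * (mlOp (N0 ℓ Mh c.k (boxP ℓ c.M c.ρ c.k c.k)) ℓ c.k (levD Mh c) aw *ᵥ fh) y' := by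
    intro y'
    have hmem : y'.1 - t + t ∈ boxDom (N0 ℓ Mh c.k (boxP ℓ c.M c.ρ c.k c.k)) := by rw [sub_add_cancel]; exact y'.2
    have hy' : (⟨y'.1 - t + t, hmem⟩ : ↥(boxDom (N0 ℓ Mh c.k (boxP ℓ c.M c.ρ c.k c.k)))) = y' := Subtype.ext (sub_add_cancel _ _)
    simp only [hg₂, dif_pos hmem, hy']
  have hsum : (∑ y' : ↥(boxDom (N0 ℓ Mh c.k (boxP ℓ c.M c.ρ c.k c.k))),
        mlOp (N0 ℓ Mh c.k (boxP ℓ c.M c.ρ c.k c.k)) ℓ c.k (levD Mh c) aw y y' * g₂ (y'.1 - t))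
      = ∑ y' : ↥(boxDom (N0 ℓ Mh c.k (boxP ℓ c.M c.ρ c.k c.k))), mlOp (N0 ℓ Mh c.k (boxP ℓ c.M c.ρ c.k c.k)) ℓ c.k (levD Mh c) aw y y' *
          ((η ^ 2)⁻¹ * (mlOp (N0 ℓ Mh c.k (boxP ℓ c.M c.ρ c.k c.k)) ℓ c.k (levD Mh c) aw *ᵥ fh) y') :=
    Finset.sum_congr rfl fun y' _ => by rw [hg₂y y']
  rw [hsum, show (mlOp (N0 ℓ Mh c.k (boxP ℓ c.M c.ρ c.k c.k)) ℓ c.k (levD Mh c) aw *ᵥ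
      (mlOp (N0 ℓ Mh c.k (boxP ℓ c.M c.ρ c.k c.k)) ℓ c.k (levD Mh c) aw *ᵥ fh)) y
      = ∑ y' : ↥(boxDom (N0 ℓ Mh c.k (boxP ℓ c.M c.ρ c.k c.k))), mlOp (N0 ℓ Mh c.k (boxP ℓ c.M c.ρ c.k c.k)) ℓ c.k (levD Mh c) aw y y' *
          (mlOp (N0 ℓ Mh c.k (boxP ℓ c.M c.ρ c.k c.k)) ℓ c.k (levD Mh c) aw *ᵥ fh) y' from rfl,
    Finset.mul_sum, Finset.mul_sum]
  refine Finset.sum_congr rfl fun y' _ => ?_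
  ring

end Literature.MathematicalPhysics.QuantumFieldTheory.Balaban1983to89.B8DentedCubeMemberBoxRowsL0
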